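import Mathlib.Analysis.SpecialFunctions.Pow.Real
import Mathlib.Analysis.Complex.Basic
import Literature.Computability.AlgebraicComplexity.AsymptoticSpectrum
import Literature.Computability.AlgebraicComplexity.BorderRankCW
import HarnessLib

/-!
# Alman–Li 2026: the asymptotic rank of the little Coppersmith–Winograd tensor is below its border rank

Topic `Literature/Computability/AlgebraicComplexity`. NAMED FACTS (stated, not proved here) from
J. Alman, B. Li, *Asymptotic Rank Speedup Theorems, Revisited*, arXiv:2605.21738 (20 May 2026), read
from the held text `paper:arxiv-2605.21738` (chunks p0004, p0011, p0015–p0018).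

* **Theorem 1.3** (p0004): "`R̃(cw_2) < 3.931`."  Before this paper the best upper bound was the border
  rank, `R̃(cw_2) ≤ bR(cw_2) = 4`; the value `R̃(cw_2) = 3 = q + 1` would give `ω = 2`
  (Coppersmith–Winograd 1990, §11).  Here `cw_q` is the tree's `cwTensor K q` (format `(q+1)³`,
  `BorderRankCW.lean`) and `R̃` is the tree's `asymptoticRank` (`AsymptoticSpectrum.lean`, the infimum
  `inf_{N ≥ 1} R(T^{⊠N})^{1/N}`; the paper, §3.1 p0008, uses the limit, equal to the infimum by Fekete).
* **Proposition 7.1 / Corollary 7.1** (p0017): from the slack of the Coppersmith–Winograd border-rank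
  identity (a functional on one mode making `Σ c'_i a_i b_i` of rank `q`, Lemma 7.1) the one-slice
  speedup theorem gives the degeneration
  `cw_q^{⊗n} ⊕ ⟨1, (q+2)^n − 2(q+1)^n + q^n, 1⟩ ⊵ ⟨(q+2)^n⟩ ⊕ ⟨1, q^n, 1⟩`, and Strassen duality
  (Prop. 5.1 there, p0011: `T ⊕ ⟨1,t,1⟩ ⊴ ⟨r⟩ ⊕ ⟨1,s,1⟩` in the three directions and `t > s` give
  `R̃(T) ≤ r + s^{2/3} − t^{2/3}`) turns it into
  `R̃(cw_q) ≤ γ_{q,n} := ((q+2)^n + q^{2n/3} − ((q+2)^n − 2(q+1)^n + q^n)^{2/3})^{1/n}` for every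
  `n ≥ 1`, `γ_q := min_n γ_{q,n} < q + 2`.  For `q = 2` the minimum is `γ_{2,4} ≈ 3.9335`; the
  iterated identity of Theorem 6.2 at `n = 4` gives the quoted `3.931`.
* Remark of this file (NOT a statement of the paper, hence not recorded as a fact): Theorem 6.2 taken
  at `n = 3` (`r = 64`, `s = 8`, `t = 18`, `t' = 18² + 2·27² = 1782`) gives
  `R̃(cw_2)³ ≤ √(68² − 1782^{2/3} + 18^{4/3}) − 18^{2/3} ≈ 60.394`, i.e. `R̃(cw_2) ≤ 3.9235`; the paper
  evaluates the iterated bound only at the `n` optimal for Cor. 7.1.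

Stated over `ℂ` (the paper fixes an arbitrary base field for the speedup theorems; the CW identity it
starts from is the classical one over fields of characteristic `0`).

What is deliberately NOT here: the speedup theorems themselves (Thm. 5.1, 6.1–6.3: they quantify over
degenerations with one-slice summands and "full / isolated" slices), Remark 6.1 (the open
constant-factor question) and Remark 7.1 (no consequence for `ω` through the laser method).
-/

namespace Literature.Computability.AlgebraicComplexity

/-- **Alman–Li 2026, Theorem 1.3.** The asymptotic rank of the little Coppersmith–Winograd tensor
`T_{cw,2}` satisfies `R̃(T_{cw,2}) < 3.931` (border rank `4`; `3` would give `ω = 2`). Named fact, not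
proved here. [cite: AlmanLi2026, Thm 1.3] -/
def AlmanLi2026_asymptoticRank_cwTwo_lt : Prop :=
  asymptoticRank (cwTensor ℂ 2) < 3.931

/-- **Alman–Li 2026, Corollary 7.1.** For every `q ≥ 2` and `n ≥ 1`,
`R̃(T_{cw,q}) ≤ γ_{q,n} = ((q+2)^n + (q^n)^{2/3} − ((q+2)^n − 2(q+1)^n + q^n)^{2/3})^{1/n}`
(all bases are nonnegative reals: the inner difference is a second difference of the convex `x ↦ x^n`).
Named fact, not proved here. [cite: AlmanLi2026, Cor 7.1] -/
def AlmanLi2026_asymptoticRank_cw_le_gamma : Prop :=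
  ∀ q n : ℕ, 2 ≤ q → 1 ≤ n →
    asymptoticRank (cwTensor ℂ q) ≤
      (((q : ℝ) + 2) ^ n + (((q : ℝ) ^ n) ^ (2 / 3 : ℝ))
          - (((q : ℝ) + 2) ^ n - 2 * ((q : ℝ) + 1) ^ n + (q : ℝ) ^ n) ^ (2 / 3 : ℝ)) ^ ((n : ℝ)⁻¹)

/-- The fact of Theorem 1.3 in the form most statements use: an upper bound strictly below the border
rank `4`. [cite: AlmanLi2026, Thm 1.3] -/
theorem asymptoticRank_cwTwo_lt_four (h : AlmanLi2026_asymptoticRank_cwTwo_lt) :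
    asymptoticRank (cwTensor ℂ 2) < 4 :=
  lt_trans h (by norm_num)

end Literature.Computability.AlgebraicComplexity
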